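import Summits.QuantumFields.BalabanUV.Beta.FP.ResidualModeSymbols

/-!
# `BalabanUV.Beta.FP.ResidualModeSymbolBound` — road «FP» (binder row D1), row H′2-IR ∕ IR-3 «IR-3-ELL-REAL», file 1∕2: the RESIDUAL-MODE SYMBOL
# `m_B(k) := Mid(k) · Re d̂^c(k)† Ĉ_n(k)⁻¹ d̂^c(k)` on the punctured real zone and its reduction to ONE alias estimate —
# `Mid·|d̂^c|⁴ ≤ Re d̂^c†Ĉ_n d̂^c ≤ Mid·|d̂^c|⁴ + T∕γ` and **`m_B(k) ≥ 1 ∕ (1 + T(k) ∕ (γ·Mid(k)·|d̂^c(k)|⁴))`**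

NOT IN PRINT; OUR BOOKKEEPING for the road-FP OWNER's `IR3-DESIGN.md` §2 IR-3-ELL (E-FP-5-4∕E-FP-5-5: «`L_C ≥ c₀Mid⁻¹` ⟺ `M_B ≥ c₀` ⟺ `inf_k m_{B,n}(k) ≥ c₀`»;
OFFER «IR-3-ELL-REAL» journal l.22229).  Objects (unnormalised weights — `m_B` is a ratio, E-FP-5-3): for a coarse momentum `k`, alias index `a`, `q_a := apt n a k`,
`bw_a := Π_i gsum ((q_a)_i) n` (block-mean weight), `cweight n μ (q_a) = bw_a·gsum ((q_a)_μ) n` (contour weight), `P̂_a := PinfSym (wrapPt q_a) (d1Sym (wrapPt q_a))`,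
`Δ̂_a := Σ_ν ‖d1Sym q_a ν‖²`, `dc := d1Sym k` (the COARSE difference symbol): `Ĉ_n(k)_{κλ} := covSym n κ λ (PbfSym κ λ) (ofRealVec k) = (n^{d+1})⁻¹ Σ_a cw_κ P̂_a cw̄_λ`
(`CoarseCovarianceAliasBF.covSym_PbfSym_ofRealVec`), `Mid(k) := (n^{d+1})⁻¹ Σ_a |bw_a|²∕Δ̂_a²` (the symbol of `Q′Δ⁻²Q′ᵀ` with the same prefactor),
`T(k) := (n^{d+1})⁻¹ Σ_a |bw_a|²·(Σ_μ |gsum((q_a)_μ) n|²‖dc_μ‖²)∕Δ̂_a`.  ROUTE: (1) `Re v†Ĉv = (n^{d+1})⁻¹ Σ_a Re u_a†P̂_a u_a`, `u_a = conj(cw)·v`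
(`CoarseCovarianceEllipticBound.quad_covSym_PbfSym_eq`); (2) at `v = dc`, (P2) in symbols (`ResidualModeSymbols`) gives `u_a = conj(bw_a)·Λ_a d̂(q_a)` and the GAUGE SHARE
`|d̂(q_a)†u_a|²∕Δ̂_a² = |bw_a|²|dc|⁴∕Δ̂_a²` EXACTLY; (3) the transverse share is `≥ 0` (`re_quad_PinfSym_ge_gauge`) and `≤ Σ‖u_a‖²∕(γΔ̂_a)` (`re_quad_PinfSym_le`,
the quantitative inverse of gan24-leaf-05-g34's `PerfectPropagatorBound`); (4) `Ĉ_n(k)` is Hermitian positive definite for `k ∈ BZ∖{0}` (IR-2 (iii)), so by completion of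
squares at the single vector `dc` (`re_quad_inv_ge_self`) `Re dc†Ĉ⁻¹dc ≥ |dc|⁴∕Re dc†Ĉdc`.  File 2∕2 (`ResidualModeAliasBound`) bounds `T ≤ A′(d)·Mid·|dc|⁴` n-FREE with
leaf-17's alias-weight sums, giving `m_B ≥ c₀(d)`.

## What is proved (`0 sorry`, every `d`, `n ≥ 1`; `k ∈ BZ`, `k ≠ 0` where inverses enter)
* §1 [our object] defs `cMat`, `bweight`, `lapD`, `midSym`, `transT`, `mB`; [folklore] `d1Sym_wrapPt` (`d1Sym (wrapPt q) = d1Sym q`), `lapD_wrapPt`, `wrapPt_apt_ne_zero`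
  (`k ∈ BZ∖{0}` ⟹ no alias momentum is a lattice point), `d1Sym_wrapPt_apt_ne_zero`, `lapD_apt_pos`, `gsum_mul_d1Sym_apt` ((P2), real form: `gsum((q_a)_μ) n·d1Sym q_a μ = d1Sym k μ`).
* §2 [our object] `quad_cMat`, `cMat_isHermitian`, `re_quad_cMat_nonneg`, **`re_quad_cMat_pos`**, `cMat_mulVec_injective`, **`isUnit_cMat_det`**, `cMat_mul_inv`.
* §3 [folklore] **`re_quad_inv_ge_self`** (Hermitian `F`, `F * P = 1`, `0 ≤ Re w†Fw` ∀ w, `0 < Re v†Fv` ⟹ `(Σ‖v‖²)²∕Re v†Fv ≤ Re v†Pv`); [our object] `re_quad_PinfSym_le`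
  (`Re u†P̂u ≤ Σ‖u‖²∕((4∕π²)^{d+3}·Σ‖ph‖²)`).
* §4 [our object] `star_d1Sym_dotProduct_u` (the gauge share, exact), **`re_quad_cMat_d1Sym_ge`** (`midSym·(Σ‖dc‖²)² ≤ Re dc†Ĉdc`), **`re_quad_cMat_d1Sym_le`**
  (`≤ midSym·(Σ‖dc‖²)² + transT∕γ`), `midSym_pos`, **`mB_ge`** (`1∕(1 + transT∕(γ·midSym·(Σ‖dc‖²)²)) ≤ mB n k`).
HONEST FRAMING: symbol inequalities for the cell's own U = 1 objects; 0 estimates of Bałaban's objects; 0∕4 row-D1 binders; NOT D1, NOT BetaPertH, NOT the continuum limit, NOT Clay.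
HONEST DEPENDENCY (verbatim): «continuum YM on T⁴ ⇐ BetaPertH ∧ nine spine estimates (0/9 proved); BetaPertH ⇐ (D1) ∧ (D4) ∧ CAP+tail; G-an2-4 gates asym, D1 and NE2/3/4.»
ABSOLUTE RULE respected: no cited fact, no `def … : Prop`, nothing of the manuscripts asserted.
Provenance: D1 formalisation swarm leaf prover 02, gen 7 (prover-b2b-balaban-beta-d1-formalise-leaf-02-g7-0), road-FP «IR-3-ELL-REAL» offer (journal l.22229), 2026-08-20.
-/

noncomputable section

open Complex Set Finset Matrix
open scoped Real BigOperators ComplexConjugate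
open Literature.MathematicalPhysics.QuantumFieldTheory.Balaban1983to89
open B4Strip (ofRealVec)
open B4ContourShift (BZ)
open B5Prop11Fiber (d1Sym)
open Summit.QuantumFields.BalabanUV.Beta.GAN24.FibreSymbols (gsum)
open Summit.QuantumFields.BalabanUV.Beta.GAN24.AliasTiling (apt)
open Summit.QuantumFields.BalabanUV.Beta.GAN24.AliasDecimate (aliasPt aliasPt_ofRealVec)
open Summit.QuantumFields.BalabanUV.Beta.GAN24.AliasWeights (geomExp_mul_sub_one)
open Summit.QuantumFields.BalabanUV.Beta.GAN24.PushSumSymbol (cweight)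
open Summit.QuantumFields.BalabanUV.Beta.FP.PerfectSymbol166 (W166Inf)
open Summit.QuantumFields.BalabanUV.Beta.FP.PerfectMaxwellSymbol (maxwellQ)
open Summit.QuantumFields.BalabanUV.Beta.FP.PerfectPropagatorSymbol (feynMat quad PinfSym quad_eq_dotProduct feynMat_isHermitian feynMat_mul_PinfSym)
open Summit.QuantumFields.BalabanUV.Beta.FP.PerfectPropagatorBound (sum_norm_sq_pos d1Sym_ne_zero re_star_dotProduct_le sq_mul_sum_norm_sq_PinfSym_mulVec_le
  re_quad_feynMat_ge)
open Summit.QuantumFields.BalabanUV.Beta.FP.CoarseCovarianceAlias (covSym)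
open Summit.QuantumFields.BalabanUV.Beta.FP.CoarseCovarianceAliasBF (wrapPt wrapPt_mem_BZ PbfSym covSym_PbfSym_ofRealVec)
open Summit.QuantumFields.BalabanUV.Beta.FP.CoarseCovarianceElliptic (star_dotProduct_self re_quad_sub_smul re_quad_PinfSym_nonneg re_quad_PinfSym_ge)
open Summit.QuantumFields.BalabanUV.Beta.FP.CoarseCovarianceEllipticBound (quad_covSym_PbfSym_eq norm_cweight_apt_zero_ge apt_zero_mem_BZ
  wrapPt_ne_zero_of_mem)
open Summit.QuantumFields.BalabanUV.Beta.FP.ResidualModeSymbols (PinfSym_isHermitian re_quad_PinfSym_eq_maxwellQ_add re_quad_PinfSym_ge_gauge cweight_eq_prod_mul)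

namespace Summit.QuantumFields.BalabanUV.Beta.FP.ResidualModeSymbolBound

variable {d : ℕ}

/-! ## §1 Objects and elementary facts -/

/-- [our object] THE COARSE COVARIANCE SYMBOL MATRIX at a real coarse momentum: `Ĉ_n(k)_{κλ} := covSym n κ λ (PbfSym κ λ) (ofRealVec k)`. -/
def cMat (n : ℕ) (k : Fin (d + 1) → ℝ) : Matrix (Fin (d + 1)) (Fin (d + 1)) ℂ := fun κ l => covSym n κ l (PbfSym κ l) (ofRealVec k)

/-- [our object] THE BLOCK-MEAN WEIGHT `Π_i gsum (q_i) n` (the straight block sum of the plane wave). -/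
def bweight (n : ℕ) (q : Fin (d + 1) → ℂ) : ℂ := ∏ i, gsum (q i) n

/-- [our object] THE LAPLACIAN SYMBOL in `d1Sym` currency: `Δ̂(q) := Σ_ν ‖e^{iq_ν} − 1‖²`. -/
def lapD (q : Fin (d + 1) → ℝ) : ℝ := ∑ ν, ‖d1Sym q ν‖ ^ 2

/-- [our object] THE BLOCK-MEAN BI-LAPLACIAN SYMBOL `Mid(k) := (n^{d+1})⁻¹ Σ_a |bw_a|² ∕ Δ̂(q_a)²` (symbol of `Q′Δ⁻²Q′ᵀ`, same prefactor as `cMat`). -/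
def midSym (n : ℕ) (k : Fin (d + 1) → ℝ) : ℝ :=
  ((n : ℝ) ^ (d + 1))⁻¹ * ∑ a : Fin (d + 1) → Fin n, ‖bweight n (ofRealVec (apt n a k))‖ ^ 2 / lapD (apt n a k) ^ 2

/-- [our object] THE TRANSVERSE MAJORANT `T(k) := (n^{d+1})⁻¹ Σ_a |bw_a|²·(Σ_μ |gsum((q_a)_μ) n|²·‖dc_μ‖²) ∕ Δ̂(q_a)`. -/
def transT (n : ℕ) (k : Fin (d + 1) → ℝ) : ℝ :=
  ((n : ℝ) ^ (d + 1))⁻¹ * ∑ a : Fin (d + 1) → Fin n,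
    ‖bweight n (ofRealVec (apt n a k))‖ ^ 2 * (∑ μ, ‖gsum (ofRealVec (apt n a k) μ) n‖ ^ 2 * ‖d1Sym k μ‖ ^ 2) / lapD (apt n a k)

/-- [our object] **THE RESIDUAL-MODE SYMBOL** `m_B(k) := Mid(k) · Re d̂^c(k)† Ĉ_n(k)⁻¹ d̂^c(k)`, `d̂^c = d1Sym k`. -/
def mB (n : ℕ) (k : Fin (d + 1) → ℝ) : ℝ := midSym n k * (quad (cMat n k)⁻¹ (d1Sym k)).re

/-- [folklore] The fine difference symbol is `2π`-periodic: `d1Sym (wrapPt q) = d1Sym q`. -/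
theorem d1Sym_wrapPt (q : Fin (d + 1) → ℝ) : d1Sym (wrapPt q) = d1Sym q := by
  funext μ
  unfold d1Sym wrapPt
  obtain ⟨_, z, hz⟩ := (toIocMod_eq_iff Real.two_pi_pos).1 (rfl : toIocMod Real.two_pi_pos (-π) (q μ) = _)
  -- `q μ = toIocMod … + z • 2π`
  conv_rhs => rw [hz]
  rw [zsmul_eq_mul]
  push_cast
  rw [add_mul, Complex.exp_add, show ((z : ℂ) * (2 * π)) * I = (z : ℂ) * (2 * π * I) by ring, Complex.exp_int_mul_two_pi_mul_I, mul_one]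

/-- [folklore] Hence `Δ̂(wrapPt q) = Δ̂(q)`. -/
theorem lapD_wrapPt (q : Fin (d + 1) → ℝ) : lapD (wrapPt q) = lapD q := by
  unfold lapD; rw [d1Sym_wrapPt]

/-- [folklore] `apt n a k i = (k i + 2π a_i)/n`. -/
theorem apt_apply (n : ℕ) (a : Fin (d + 1) → Fin n) (k : Fin (d + 1) → ℝ) (i : Fin (d + 1)) :
    apt n a k i = (k i + 2 * π * ((a i : ℕ) : ℝ)) / n := rfl

/-- [folklore] **NO ALIAS MOMENTUM OF A PUNCTURED-ZONE MOMENTUM IS A LATTICE POINT**: `k ∈ BZ`, `k ≠ 0` ⟹ `wrapPt (apt n a k) ≠ 0` for every `a`. -/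
theorem wrapPt_apt_ne_zero (n : ℕ) [NeZero n] {k : Fin (d + 1) → ℝ} (hk : k ∈ BZ (d + 1)) (hk0 : k ≠ 0) (a : Fin (d + 1) → Fin n) :
    wrapPt (apt n a k) ≠ 0 := by
  have hn : (0 : ℝ) < n := by exact_mod_cast Nat.pos_of_ne_zero (NeZero.ne n)
  intro h
  apply hk0
  funext i
  have hi : wrapPt (apt n a k) i = 0 := by rw [h]; rfl
  unfold wrapPt at hi
  obtain ⟨_, z, hz⟩ := (toIocMod_eq_iff Real.two_pi_pos).1 hi
  rw [apt_apply, zsmul_eq_mul, zero_add] at hz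
  have hki : k i = 2 * π * ((z : ℝ) * n - ((a i : ℕ) : ℝ)) := by
    field_simp at hz
    linarith
  unfold BZ at hk; rw [Set.mem_Icc] at hk
  have h1 := hk.1 i; have h2 := hk.2 i
  set m : ℤ := z * n - ((a i : ℕ) : ℤ) with hm
  have hmr : ((z : ℝ) * n - ((a i : ℕ) : ℝ)) = (m : ℝ) := by rw [hm]; push_cast; ring
  rw [hmr] at hki
  have hπ := Real.pi_pos
  have hmle : (m : ℝ) ≤ 1 / 2 := by nlinarith
  have hmge : -(1 / 2 : ℝ) ≤ (m : ℝ) := by nlinarith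
  have hm0 : m = 0 := by
    have a1 : (m : ℝ) < 1 := by linarith
    have a2 : (-1 : ℝ) < m := by linarith
    have b1 : m < 1 := by exact_mod_cast a1
    have b2 : -1 < m := by exact_mod_cast a2
    omega
  rw [hki, hm0]; simp

/-- [folklore] … so the momentum factors of every alias never vanish on the punctured zone. -/
theorem d1Sym_wrapPt_apt_ne_zero (n : ℕ) [NeZero n] {k : Fin (d + 1) → ℝ} (hk : k ∈ BZ (d + 1)) (hk0 : k ≠ 0) (a : Fin (d + 1) → Fin n) :
    d1Sym (wrapPt (apt n a k)) ≠ 0 :=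
  d1Sym_ne_zero (wrapPt_mem_BZ _) (wrapPt_apt_ne_zero n hk hk0 a)

/-- [folklore] `Δ̂(q_a) = Σ‖d1Sym (wrapPt q_a)‖² > 0` on the punctured zone. -/
theorem lapD_apt_pos (n : ℕ) [NeZero n] {k : Fin (d + 1) → ℝ} (hk : k ∈ BZ (d + 1)) (hk0 : k ≠ 0) (a : Fin (d + 1) → Fin n) :
    0 < lapD (apt n a k) := by
  rw [← lapD_wrapPt]
  exact sum_norm_sq_pos (d1Sym_wrapPt_apt_ne_zero n hk hk0 a)

/-- [folklore] **(P2), REAL FORM**: `gsum ((q_a)_μ) n · d1Sym q_a μ = d1Sym k μ` — the geometric sum along the contour telescopes the fine difference at the alias momentum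
into the coarse difference (`geomExp_mul_sub_one` + `e^{i n (q_a)_μ} = e^{i k_μ}`). -/
theorem gsum_mul_d1Sym_apt (n : ℕ) [NeZero n] (a : Fin (d + 1) → Fin n) (k : Fin (d + 1) → ℝ) (μ : Fin (d + 1)) :
    gsum (ofRealVec (apt n a k) μ) n * d1Sym (apt n a k) μ = d1Sym k μ := by
  have hn : (n : ℂ) ≠ 0 := by exact_mod_cast NeZero.ne n
  have h := geomExp_mul_sub_one (ofRealVec (apt n a k) μ) n
  unfold gsum d1Sym
  rw [show ((apt n a k μ : ℝ) : ℂ) * I = I * ofRealVec (apt n a k) μ by unfold ofRealVec; ring, h]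
  simp only [ofRealVec, apt_apply]
  push_cast
  rw [show I * ((↑(k μ) + 2 * ↑π * ((a μ : ℕ) : ℂ)) / (n : ℂ)) * (n : ℂ) = ↑(k μ) * I + ((a μ : ℕ) : ℂ) * (2 * π * I) by field_simp,
    Complex.exp_add, Complex.exp_nat_mul_two_pi_mul_I, mul_one]

/-- [folklore] `cweight n μ q = bweight n q · gsum (q_μ) n`. -/
theorem cweight_eq_bweight_mul (n : ℕ) (μ : Fin (d + 1)) (q : Fin (d + 1) → ℂ) : cweight n μ q = bweight n q * gsum (q μ) n := rfl

/-! ## §2 The symbol matrix: form, Hermitian symmetry, positivity, invertibility -/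

/-- [our object] THE FORM OF `Ĉ_n(k)` as the alias average of propagator forms (`CoarseCovarianceEllipticBound.quad_covSym_PbfSym_eq`). -/
theorem quad_cMat (n : ℕ) (k : Fin (d + 1) → ℝ) (v : Fin (d + 1) → ℂ) :
    quad (cMat n k) v = ((n : ℂ) ^ (d + 1))⁻¹ * ∑ a : Fin (d + 1) → Fin n,
      quad (PinfSym (wrapPt (apt n a k)) (d1Sym (wrapPt (apt n a k)))) (fun l => conj (cweight n l (ofRealVec (apt n a k))) * v l) := by
  unfold quad cMat
  exact quad_covSym_PbfSym_eq n k v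

/-- [our object] `Ĉ_n(k)` is Hermitian (each `P̂_a` is, and the weights are diagonal). -/
theorem cMat_isHermitian (n : ℕ) (k : Fin (d + 1) → ℝ) : (cMat n k).IsHermitian := by
  refine Matrix.IsHermitian.ext fun κ l => ?_
  simp only [cMat, covSym_PbfSym_ofRealVec, Complex.star_def, map_mul, map_sum, map_inv₀, map_pow, Complex.conj_natCast, Complex.conj_conj]
  congr 1
  refine Finset.sum_congr rfl fun a _ => ?_
  have hP := (PinfSym_isHermitian (wrapPt (apt n a k)) (d1Sym (wrapPt (apt n a k)))).apply κ l
  rw [Complex.star_def] at hP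
  rw [hP]
  ring

/-- [our object] The form of `Ĉ_n(k)` is nonnegative at every real `k`. -/
theorem re_quad_cMat_nonneg (n : ℕ) [NeZero n] (k : Fin (d + 1) → ℝ) (v : Fin (d + 1) → ℂ) : 0 ≤ (quad (cMat n k) v).re := by
  rw [quad_cMat]
  have r2 : (((n : ℂ) ^ (d + 1))⁻¹) = ((((n : ℝ) ^ (d + 1))⁻¹ : ℝ) : ℂ) := by push_cast; ring
  rw [r2, Complex.re_ofReal_mul, Complex.re_sum]
  exact mul_nonneg (by positivity) (Finset.sum_nonneg fun a _ => re_quad_PinfSym_nonneg (wrapPt_mem_BZ _) _ _)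

/-- [our object] **`Ĉ_n(k)` IS POSITIVE DEFINITE ON THE PUNCTURED ZONE**: `0 < Re v†Ĉ_n(k)v` for `k ∈ BZ`, `k ≠ 0`, `v ≠ 0` (IR-2 (iii): the `l = 0` term alone). -/
theorem re_quad_cMat_pos (n : ℕ) [NeZero n] {k : Fin (d + 1) → ℝ} (hk : k ∈ BZ (d + 1)) (hk0 : k ≠ 0) {v : Fin (d + 1) → ℂ} (hv : v ≠ 0) :
    0 < (quad (cMat n k) v).re := by
  have hn0 : (0 : ℝ) < n := by exact_mod_cast Nat.pos_of_ne_zero (NeZero.ne n)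
  have hext := CoarseCovarianceEllipticBound.re_quad_covSym_PbfSym_ge_alias n k v (fun _ => (0 : Fin n))
  have hquad : (∑ κ, ∑ l, conj (v κ) * covSym n κ l (PbfSym κ l) (ofRealVec k) * v l).re = (quad (cMat n k) v).re := by rfl
  rw [hquad] at hext
  refine lt_of_lt_of_le ?_ hext
  refine mul_pos (by positivity) ?_
  set s' := wrapPt (apt n (fun _ => (0 : Fin n)) k) with hs'
  set u : Fin (d + 1) → ℂ := fun l => conj (cweight n l (ofRealVec (apt n (fun _ => (0 : Fin n)) k))) * v l with hu
  have hs'BZ : s' ∈ BZ (d + 1) := wrapPt_mem_BZ _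
  have hs'0 : s' ≠ 0 := wrapPt_apt_ne_zero n hk hk0 _
  have hph0 : d1Sym s' ≠ 0 := d1Sym_ne_zero hs'BZ hs'0
  have hu0 : u ≠ 0 := by
    obtain ⟨α, hα⟩ : ∃ α, v α ≠ 0 := by by_contra h; push Not at h; exact hv (funext h)
    intro h0
    have := congrFun h0 α
    rw [hu, Pi.zero_apply, mul_eq_zero] at this
    rcases this with h1 | h1
    · have hq := norm_cweight_apt_zero_ge n hk α
      rw [map_eq_zero] at h1
      rw [h1, norm_zero] at hq
      have : (0 : ℝ) < (2 / Real.pi * n) ^ (d + 2) := by positivity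
      linarith
    · exact hα h1
  have hP := re_quad_PinfSym_ge hs'BZ hs'0 hph0 u
  have hpos : 0 < (∑ α, ‖u α‖ ^ 2) / ((Real.pi ^ 2 / 4) ^ (2 * (d + 1) + 4) * ∑ μ, ‖d1Sym s' μ‖ ^ 2) :=
    div_pos (sum_norm_sq_pos hu0) (mul_pos (by positivity) (sum_norm_sq_pos hph0))
  exact lt_of_lt_of_le hpos hP

/-- [our object] Hence `v ↦ Ĉ_n(k)·v` is injective. -/
theorem cMat_mulVec_injective (n : ℕ) [NeZero n] {k : Fin (d + 1) → ℝ} (hk : k ∈ BZ (d + 1)) (hk0 : k ≠ 0) :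
    Function.Injective (cMat n k).mulVec := by
  intro v w hvw
  by_contra hne
  have hsub : v - w ≠ 0 := sub_ne_zero.mpr hne
  have hpos := re_quad_cMat_pos n hk hk0 hsub
  have hz : (cMat n k) *ᵥ (v - w) = 0 := by rw [mulVec_sub, hvw, sub_self]
  rw [quad_eq_dotProduct, hz, dotProduct_zero, Complex.zero_re] at hpos
  exact lt_irrefl _ hpos

/-- [our object] … and **`Ĉ_n(k)` IS INVERTIBLE** on the punctured zone. -/
theorem isUnit_cMat_det (n : ℕ) [NeZero n] {k : Fin (d + 1) → ℝ} (hk : k ∈ BZ (d + 1)) (hk0 : k ≠ 0) : IsUnit (cMat n k).det :=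
  (Matrix.isUnit_iff_isUnit_det _).mp (Matrix.mulVec_injective_iff_isUnit.mp (cMat_mulVec_injective n hk hk0))

/-- [our object] `Ĉ_n(k) · Ĉ_n(k)⁻¹ = 1` on the punctured zone. -/
theorem cMat_mul_inv (n : ℕ) [NeZero n] {k : Fin (d + 1) → ℝ} (hk : k ∈ BZ (d + 1)) (hk0 : k ≠ 0) : cMat n k * (cMat n k)⁻¹ = 1 :=
  Matrix.mul_nonsing_inv _ (isUnit_cMat_det n hk hk0)

/-! ## §3 Two form inequalities: the inverse from below at a single vector, the propagator from above -/

/-- [folklore] **COMPLETION OF SQUARES AT A SINGLE VECTOR**: `F` Hermitian, `F * P = 1`, `0 ≤ Re w†Fw` for all `w`, and `0 < Re v†Fv` ⟹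
`(Σ‖v‖²)² ∕ Re v†Fv ≤ Re v†Pv` (take `w = Pv`, `t = Σ‖v‖²∕Re v†Fv` in `0 ≤ Re (w − tv)†F(w − tv)`). -/
theorem re_quad_inv_ge_self {m : ℕ} {F P : Matrix (Fin m) (Fin m) ℂ} (hF : F.IsHermitian) (hFP : F * P = 1)
    (hpos : ∀ w : Fin m → ℂ, 0 ≤ (star w ⬝ᵥ (F *ᵥ w)).re) (v : Fin m → ℂ) (hb : 0 < (quad F v).re) :
    (∑ α, ‖v α‖ ^ 2) ^ 2 / (quad F v).re ≤ (quad P v).re := by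
  set w : Fin m → ℂ := P *ᵥ v with hw
  have hFw : F *ᵥ w = v := by rw [hw, mulVec_mulVec, hFP, one_mulVec]
  have hq : (quad P v).re = (star w ⬝ᵥ (F *ᵥ w)).re := by
    rw [quad_eq_dotProduct, hFw, hw, star_dotProduct]
    simp only [Complex.star_def, Complex.conj_re]
  set s : ℝ := ∑ α, ‖v α‖ ^ 2 with hs
  set b : ℝ := (quad F v).re with hbdef
  have hbq : (star v ⬝ᵥ (F *ᵥ v)).re = b := by rw [hbdef, quad_eq_dotProduct]
  have h0 := hpos (w - ((s / b : ℝ) : ℂ) • v)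
  rw [re_quad_sub_smul hF hFw, hbq] at h0
  rw [hq]
  have e : (s / b) ^ 2 * b = s ^ 2 / b := by field_simp
  have e2 : 2 * (s / b) * s = 2 * (s ^ 2 / b) := by field_simp
  rw [← hs, e, e2] at h0
  linarith

/-- [our object] **THE PROPAGATOR FORM FROM ABOVE**: for `s ∈ BZ`, `ph ≠ 0`, `Re u†(PinfSym s ph)u ≤ Σ‖u‖² ∕ ((4∕π²)^{(d+1)+2}·Σ‖ph‖²)`
(`w := P̂u`: `γ|ph|²‖w‖² ≤ Re w†Fw = Re w†u ≤ ‖w‖‖u‖`, so `Re u†P̂u = Re u†w ≤ ‖u‖‖w‖ ≤ ‖u‖²∕(γ|ph|²)`). -/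
theorem re_quad_PinfSym_le {s : Fin (d + 1) → ℝ} (hs : s ∈ BZ (d + 1)) {ph : Fin (d + 1) → ℂ} (hph : ph ≠ 0) (u : Fin (d + 1) → ℂ) :
    (quad (PinfSym s ph) u).re ≤ (∑ α, ‖u α‖ ^ 2) / ((4 / Real.pi ^ 2) ^ (d + 1 + 2) * ∑ μ, ‖ph μ‖ ^ 2) := by
  set γ' : ℝ := (4 / Real.pi ^ 2) ^ (d + 1 + 2) * ∑ μ, ‖ph μ‖ ^ 2 with hγ'
  have hγ'pos : 0 < γ' := mul_pos (by positivity) (sum_norm_sq_pos hph)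
  set w := PinfSym s ph *ᵥ u with hw
  have h1 : γ' ^ 2 * ∑ α, ‖w α‖ ^ 2 ≤ ∑ α, ‖u α‖ ^ 2 := sq_mul_sum_norm_sq_PinfSym_mulVec_le hs hph u
  have h2 : (quad (PinfSym s ph) u).re ≤ Real.sqrt (∑ α, ‖u α‖ ^ 2) * Real.sqrt (∑ α, ‖w α‖ ^ 2) := by
    rw [quad_eq_dotProduct]; exact re_star_dotProduct_le u w
  have hU : 0 ≤ ∑ α, ‖u α‖ ^ 2 := by positivity
  have hW : 0 ≤ ∑ α, ‖w α‖ ^ 2 := by positivity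
  have h3 : Real.sqrt (∑ α, ‖w α‖ ^ 2) ≤ Real.sqrt (∑ α, ‖u α‖ ^ 2) / γ' := by
    rw [le_div_iff₀ hγ'pos, ← Real.sqrt_sq hγ'pos.le, ← Real.sqrt_mul hW]
    exact Real.sqrt_le_sqrt (by nlinarith)
  calc (quad (PinfSym s ph) u).re ≤ Real.sqrt (∑ α, ‖u α‖ ^ 2) * Real.sqrt (∑ α, ‖w α‖ ^ 2) := h2
    _ ≤ Real.sqrt (∑ α, ‖u α‖ ^ 2) * (Real.sqrt (∑ α, ‖u α‖ ^ 2) / γ') :=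
        mul_le_mul_of_nonneg_left h3 (Real.sqrt_nonneg _)
    _ = (∑ α, ‖u α‖ ^ 2) / γ' := by rw [← mul_div_assoc, Real.mul_self_sqrt hU]

/-! ## §4 The sandwich for `Re d̂^c†Ĉ_n d̂^c` and the reduction of `m_B ≥ c₀` to one alias estimate -/

section Sandwich

variable (n : ℕ) [NeZero n] (k : Fin (d + 1) → ℝ)

omit [NeZero n] in
/-- [folklore] The weighted coarse-difference vector of the alias `a`: `u_a λ := conj (cweight n λ (q_a)) · d1Sym k λ`. Its squared norm:
`Σ_λ ‖u_a λ‖² = ‖bw_a‖²·Σ_λ ‖gsum((q_a)_λ) n‖²·‖d1Sym k λ‖²`. -/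
theorem sum_norm_sq_weightVec (a : Fin (d + 1) → Fin n) :
    ∑ l, ‖conj (cweight n l (ofRealVec (apt n a k))) * d1Sym k l‖ ^ 2
      = ‖bweight n (ofRealVec (apt n a k))‖ ^ 2 * ∑ l, ‖gsum (ofRealVec (apt n a k) l) n‖ ^ 2 * ‖d1Sym k l‖ ^ 2 := by
  rw [Finset.mul_sum]
  refine Finset.sum_congr rfl fun l _ => ?_
  rw [norm_mul, Complex.norm_conj, cweight_eq_bweight_mul, norm_mul]
  ring

/-- [our object] **THE GAUGE SHARE IS EXACT**: `d̂(q_a)† u_a = conj(bw_a) · Σ_μ ‖d1Sym k μ‖²` ((P2) in symbols: `conj(g_μ·d̂_μ(q_a)) = conj(dc_μ)`). -/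
theorem star_d1Sym_dotProduct_weightVec (a : Fin (d + 1) → Fin n) :
    star (d1Sym (wrapPt (apt n a k))) ⬝ᵥ (fun l => conj (cweight n l (ofRealVec (apt n a k))) * d1Sym k l)
      = conj (bweight n (ofRealVec (apt n a k))) * ((∑ μ, ‖d1Sym k μ‖ ^ 2 : ℝ) : ℂ) := by
  rw [d1Sym_wrapPt, dotProduct, Complex.ofReal_sum, Finset.mul_sum]
  refine Finset.sum_congr rfl fun μ _ => ?_
  rw [Pi.star_apply, RCLike.star_def, cweight_eq_bweight_mul, map_mul, Complex.ofReal_pow, ← Complex.conj_mul' (d1Sym k μ),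
    ← gsum_mul_d1Sym_apt n a k μ, map_mul]
  have e : gsum (ofRealVec (apt n a k) μ) n * d1Sym (apt n a k) μ = d1Sym k μ := gsum_mul_d1Sym_apt n a k μ
  rw [e]
  ring

/-- [our object] `midSym` is positive on the punctured zone (its `a = 0` term is). -/
theorem midSym_pos {k : Fin (d + 1) → ℝ} (hk : k ∈ BZ (d + 1)) (hk0 : k ≠ 0) : 0 < midSym n k := by
  have hn0 : (0 : ℝ) < n := by exact_mod_cast Nat.pos_of_ne_zero (NeZero.ne n)
  unfold midSym
  refine mul_pos (by positivity) ?_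
  refine lt_of_lt_of_le ?_ (Finset.single_le_sum (f := fun a : Fin (d + 1) → Fin n =>
      ‖bweight n (ofRealVec (apt n a k))‖ ^ 2 / lapD (apt n a k) ^ 2) (fun a _ => by positivity) (Finset.mem_univ (fun _ => (0 : Fin n))))
  have hbw : 0 < ‖bweight n (ofRealVec (apt n (fun _ => (0 : Fin n)) k))‖ := by
    have h := ResidualModeSymbols.norm_prod_gsum_apt_zero_ge n hk
    have hpos : (0 : ℝ) < (2 / Real.pi * n) ^ (d + 1) := by
      have hn0 : (0 : ℝ) < n := by exact_mod_cast Nat.pos_of_ne_zero (NeZero.ne n)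
      positivity
    exact lt_of_lt_of_le hpos h
  exact div_pos (pow_pos hbw 2) (pow_pos (lapD_apt_pos n hk hk0 _) 2)

/-- [our object] **LOWER HALF OF THE SANDWICH**: `midSym n k · (Σ‖d1Sym k‖²)² ≤ Re d̂^c† Ĉ_n(k) d̂^c` (every alias term is at least its exact gauge share). -/
theorem re_quad_cMat_d1Sym_ge {k : Fin (d + 1) → ℝ} (hk : k ∈ BZ (d + 1)) (hk0 : k ≠ 0) :
    midSym n k * (∑ μ, ‖d1Sym k μ‖ ^ 2) ^ 2 ≤ (quad (cMat n k) (d1Sym k)).re := by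
  rw [quad_cMat]
  have r2 : (((n : ℂ) ^ (d + 1))⁻¹) = ((((n : ℝ) ^ (d + 1))⁻¹ : ℝ) : ℂ) := by push_cast; ring
  rw [r2, Complex.re_ofReal_mul, Complex.re_sum, midSym, mul_assoc, Finset.sum_mul]
  refine mul_le_mul_of_nonneg_left (Finset.sum_le_sum fun a _ => ?_) (by positivity)
  have hs'BZ : wrapPt (apt n a k) ∈ BZ (d + 1) := wrapPt_mem_BZ _
  have hph0 : d1Sym (wrapPt (apt n a k)) ≠ 0 := d1Sym_wrapPt_apt_ne_zero n hk hk0 a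
  have h := re_quad_PinfSym_ge_gauge hs'BZ hph0 (fun l => conj (cweight n l (ofRealVec (apt n a k))) * d1Sym k l)
  rw [star_d1Sym_dotProduct_weightVec n k a, norm_mul, Complex.norm_conj, Complex.norm_real, Real.norm_eq_abs,
    abs_of_nonneg (by positivity : (0 : ℝ) ≤ ∑ μ, ‖d1Sym k μ‖ ^ 2)] at h
  have hlap : ∑ β, ‖d1Sym (wrapPt (apt n a k)) β‖ ^ 2 = lapD (apt n a k) := by rw [d1Sym_wrapPt]; rfl
  rw [hlap] at h
  calc ‖bweight n (ofRealVec (apt n a k))‖ ^ 2 / lapD (apt n a k) ^ 2 * (∑ μ, ‖d1Sym k μ‖ ^ 2) ^ 2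
      = (‖bweight n (ofRealVec (apt n a k))‖ * ∑ μ, ‖d1Sym k μ‖ ^ 2) ^ 2 / lapD (apt n a k) ^ 2 := by ring
    _ ≤ _ := h

/-- [our object] **UPPER HALF OF THE SANDWICH** (crude, sufficient): `Re d̂^c† Ĉ_n(k) d̂^c ≤ transT n k ∕ (4∕π²)^{d+3}` (`re_quad_PinfSym_le` alias term by alias term). -/
theorem re_quad_cMat_d1Sym_le {k : Fin (d + 1) → ℝ} (hk : k ∈ BZ (d + 1)) (hk0 : k ≠ 0) :
    (quad (cMat n k) (d1Sym k)).re ≤ transT n k / (4 / Real.pi ^ 2) ^ (d + 1 + 2) := by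
  rw [quad_cMat]
  have r2 : (((n : ℂ) ^ (d + 1))⁻¹) = ((((n : ℝ) ^ (d + 1))⁻¹ : ℝ) : ℂ) := by push_cast; ring
  rw [r2, Complex.re_ofReal_mul, Complex.re_sum, transT, mul_div_assoc, Finset.sum_div]
  refine mul_le_mul_of_nonneg_left (Finset.sum_le_sum fun a _ => ?_) (by positivity)
  have hs'BZ : wrapPt (apt n a k) ∈ BZ (d + 1) := wrapPt_mem_BZ _
  have hph0 : d1Sym (wrapPt (apt n a k)) ≠ 0 := d1Sym_wrapPt_apt_ne_zero n hk hk0 a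
  have h := re_quad_PinfSym_le hs'BZ hph0 (fun l => conj (cweight n l (ofRealVec (apt n a k))) * d1Sym k l)
  have hlap : ∑ β, ‖d1Sym (wrapPt (apt n a k)) β‖ ^ 2 = lapD (apt n a k) := by rw [d1Sym_wrapPt]; rfl
  rw [hlap, sum_norm_sq_weightVec n k a] at h
  have hl : 0 < lapD (apt n a k) := lapD_apt_pos n hk hk0 a
  calc _ ≤ _ := h
    _ = _ := by ring

/-- [our object] `transT` is positive on the punctured zone. -/
theorem transT_pos {k : Fin (d + 1) → ℝ} (hk : k ∈ BZ (d + 1)) (hk0 : k ≠ 0) : 0 < transT n k := by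
  have h1 := re_quad_cMat_d1Sym_ge n hk hk0
  have h2 := re_quad_cMat_d1Sym_le n hk hk0
  have hs : 0 < ∑ μ, ‖d1Sym k μ‖ ^ 2 := sum_norm_sq_pos (d1Sym_ne_zero hk hk0)
  have hm := midSym_pos n hk hk0
  have hγ : (0 : ℝ) < (4 / Real.pi ^ 2) ^ (d + 1 + 2) := by positivity
  have : 0 < transT n k / (4 / Real.pi ^ 2) ^ (d + 1 + 2) := lt_of_lt_of_le (by positivity) (h1.trans h2)
  exact (div_pos_iff_of_pos_right hγ).mp this

/-- [our object] **THE REDUCTION**: on the punctured zone, `(4∕π²)^{d+3} · midSym n k · (Σ‖d1Sym k‖²)² ∕ transT n k ≤ m_B(k)`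
(completion of squares at `d̂^c` for the Hermitian positive definite `Ĉ_n(k)`, then the sandwich).  File 2∕2 bounds `transT ≤ A′·midSym·(Σ‖d1Sym k‖²)²` n-free. -/
theorem mB_ge {k : Fin (d + 1) → ℝ} (hk : k ∈ BZ (d + 1)) (hk0 : k ≠ 0) :
    (4 / Real.pi ^ 2) ^ (d + 1 + 2) * (midSym n k * (∑ μ, ‖d1Sym k μ‖ ^ 2) ^ 2) / transT n k ≤ mB n k := by
  set s : ℝ := ∑ μ, ‖d1Sym k μ‖ ^ 2 with hs
  set b : ℝ := (quad (cMat n k) (d1Sym k)).re with hb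
  have hs0 : 0 < s := sum_norm_sq_pos (d1Sym_ne_zero hk hk0)
  have hm := midSym_pos n hk hk0
  have hT := transT_pos n hk hk0
  have hγ : (0 : ℝ) < (4 / Real.pi ^ 2) ^ (d + 1 + 2) := by positivity
  have h1 : midSym n k * s ^ 2 ≤ b := re_quad_cMat_d1Sym_ge n hk hk0
  have h2 : b ≤ transT n k / (4 / Real.pi ^ 2) ^ (d + 1 + 2) := re_quad_cMat_d1Sym_le n hk hk0
  have hb0 : 0 < b := lt_of_lt_of_le (by positivity) h1
  have hinv : s ^ 2 / b ≤ (quad (cMat n k)⁻¹ (d1Sym k)).re :=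
    re_quad_inv_ge_self (cMat_isHermitian n k) (cMat_mul_inv n hk hk0)
      (fun w => by rw [← quad_eq_dotProduct]; exact re_quad_cMat_nonneg n k w) (d1Sym k) hb0
  unfold mB
  calc (4 / Real.pi ^ 2) ^ (d + 1 + 2) * (midSym n k * s ^ 2) / transT n k
      = midSym n k * (s ^ 2 / (transT n k / (4 / Real.pi ^ 2) ^ (d + 1 + 2))) := by field_simp
    _ ≤ midSym n k * (s ^ 2 / b) := by
        refine mul_le_mul_of_nonneg_left ?_ hm.le
        exact div_le_div_of_nonneg_left (by positivity) hb0 h2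
    _ ≤ midSym n k * (quad (cMat n k)⁻¹ (d1Sym k)).re := mul_le_mul_of_nonneg_left hinv hm.le

end Sandwich

end Summit.QuantumFields.BalabanUV.Beta.FP.ResidualModeSymbolBound

end
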